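import Literature.NumberTheory.LFunctions.GaussianCosetZetaBounds
import Literature.NumberTheory.Sieve.FriedlanderIwaniecPrimesCharacterDetection
import Literature.NumberTheory.QuadraticFields.GaussianPrimary
import Mathlib.Analysis.Complex.RemovableSingularity
import HarnessLib

/-!
# Hecke `L`-functions of `ℚ(i)` to a modulus `M` (`4 ∣ M`) with a character `χ (mod M)` and Grössencharakter `(z/|z|)^k`

Topic `Literature/NumberTheory/LFunctions`, sequel to `GaussianCosetZetaBounds.lean`. Everything is
PROVED; no named facts.

J. Friedlander, H. Iwaniec, *The polynomial `X² + Y⁴` captures its primes*, Ann. of Math. 148 (1998),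
§16, (16.16)–(16.17): "for `m ∈ ℤ` and `χ` a multiplicative character on the residue classes modulo
`4d` in `ℤ[i]` the function `ψ(z) = χ(z) (z/|z|)^m` defines a character on odd ideals of `ℤ[i]` by
setting `ψ(𝔞) = ψ(z)` where `z` is the unique generator of `𝔞` which is primary. … To the character
(16.16) we attach the `L`-function (16.17) `L(s, ψ) = ∑_𝔞 ψ(𝔞)(N𝔞)^{-s}`. … This has a meromorphic
continuation to `ℂ`, is entire apart from a simple pole at `s = 1` in case of trivial `ψ` … By the
functional equation one derives, by applying the Phragmén–Lindelöf principle, crude but sufficient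
upper bounds for `L(s, ψ)` …: (16.18) `L(s, ψ) ≪ (d(|s|+|m|))^{1-σ}(log(4d(|s|+|m|)))²` … in
`1/2 ≤ σ ≤ 1`."

For `M : ℕ` (`[NeZero M]`, and `4 ∣ M` where primarity must be `M`-periodic), a character
`χ : MulChar (ℤ[i] ⧸ (M)) ℂ` (`GaussQuot M` of `…CharacterDetection`) and `k : ℕ`:

* `classRep`, `classEquiv` (`ℤ[i] ≃ classes × ℤ[i]`), `isPrimary_pt_iff` (for `4 ∣ M` a coset is
  primary or primary-free), `hasSum_of_classes`;
* **`heckeL M χ k s = ∑_{c mod M primary} χ(c) Z_k(s + k/2; c, M)`** — the finite combination of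
  continued coset zeta functions; **`hasSum_heckeL'`**: for `Re s > 1` it is
  `∑_{z primary} χ(z) (z/|z|)^k N(z)^{-s}` (and `hasSum_heckeL` in the normalisation
  `z^k N(z)^{-(s+k/2)}`) — FI's `L(s, ψ)`;
* **entire for `k ≥ 1`** (`differentiable_heckeL`); holomorphic off `s = 0, 1` for `k = 0`
  (`differentiableAt_heckeL`); for `k = 0` and `χ` nontrivial on the primary classes
  (`∑_{c primary} χ(c) = 0`) the entire function `heckeLE M χ = ∑_c χ(c) · dslope E_c 1` agrees with
  `L(s, χ)` off `s = 0, 1` (`heckeLE_eq`), i.e. the poles `π/M²/(s-1)` of the coset zetas cancel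
  ("entire apart from a simple pole at `s = 1` in case of trivial `ψ`");
* **uniform polynomial bounds** (the substitute for (16.18); any bound polynomial in `d`, `|k|`,
  `|t|` suffices in §16): `norm_heckeL_le_normSum` (`‖L(s, ψ)‖ ≤ ∑_{z≠0} N(z)^{-σ}`, `σ > 1`, M-free),
  `norm_heckeL_le` (`‖L(s, ψ)‖ ≤ M³ normSum(3/2) ‖(k/2+1)+s‖²` for `k ≥ 1`, `Re s ≥ -1/2`),
  `norm_sum_cosetZetaE_le`, `norm_heckeLE_le_of_le_norm_sub_one`, `norm_heckeLE_le_near_one`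
  (`k = 0`, away from and near `s = 1`, by the maximum modulus principle).

Negative frequencies `m < 0` reduce to `k = |m|` and the character `χ ∘ conj`
(`(z/|z|)^m = (z̄/|z|)^{|m|}`, primarity and norms are conjugation invariant); not needed here.

## References

* J. Friedlander, H. Iwaniec, Ann. of Math. (2) 148 (1998), 945–1040, §16 (16.16)–(16.18).
  [FriedlanderIwaniecAnnals1998]
* E. Hecke, Math. Z. 6 (1920), 11–51, §9. [HeckeMathZ1920]

## Mathlib / tree

Mathlib: `Equiv.ofBijective`, `Equiv.hasSum_iff`, `Function.Injective.hasSum_iff`, `hasSum_sum`,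
`dslope`, `Complex.differentiableOn_dslope`, `Complex.norm_le_of_forall_mem_frontier_norm_le`,
`Differentiable.fun_sum`. Tree: `GaussianCosetTheta.{pt, cosetL, cosetZeta, cosetZetaE, hasSum_cosetZeta,
norm_cosetL_le_mul_sq, norm_cosetZetaE_le, norm_term_natural_le, cosetZetaE_eq, cosetZetaE_one,
differentiable_cosetL, differentiable_cosetZetaE, differentiableAt_cosetZeta, cosetL_zero_eq}`
(`GaussianCosetZetaBounds`, `…ThetaMellin`); `GaussianTheta.{cls, rep, cls_rep, exists_rep_eq,
summable_norm_rpow_neg, norm_toComplex}`; `FriedlanderIwaniecPrimes.{GaussQuot, toQuot,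
toQuot_eq_toQuot_iff, norm_mulChar_apply_le_one}` (`…CharacterDetection`); `GaussianPrimary.{IsPrimary,
isPrimary_iff_dvd, IsPrimary.ne_zero}`.
-/

noncomputable section

open Complex Real Filter Topology Asymptotics Set MeasureTheory Finset
open scoped Nat

namespace Literature.NumberTheory.LFunctions

namespace GaussianCosetTheta

local notation "ℤ[i]" => GaussianInt

open GaussianHecke (norm_cast_real norm_ofReal_exp)

variable {M : ℕ} [NeZero M] {c : ℤ[i]}


open Literature.NumberTheory.QuadraticFields.GaussianPrimary (IsPrimary isPrimary_iff_dvd)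
open Literature.NumberTheory.Sieve.FriedlanderIwaniecPrimes (GaussQuot toQuot toQuot_eq_toQuot_iff)

/-! ### Classes modulo `M` and the class decomposition of `ℤ[i]` -/

variable (M) in
/-- The canonical representative `(a mod M) + (b mod M) i`, `0 ≤ a, b < M`, of a class modulo
`Mℤ[i]` labelled by `ZMod M × ZMod M`. [folklore] -/
def classRep (cl : ZMod M × ZMod M) : ℤ[i] := ⟨(cl.1.val : ℤ), (cl.2.val : ℤ)⟩

/-- `classRep` agrees with `GaussianTheta.rep M cl 0`, and `pt M (classRep cl) y = rep M cl (y₁, y₂)`.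
[folklore] -/
theorem pt_classRep (cl : ZMod M × ZMod M) (y : ℤ[i]) :
    pt M (classRep M cl) y = GaussianTheta.rep M cl (y.re, y.im) := by
  apply Zsqrtd.ext <;> simp [pt, classRep, GaussianTheta.rep]

variable (M) in
/-- **The class decomposition**: `(cl, y) ↦ classRep cl + M y` is a bijection
`(ZMod M × ZMod M) × ℤ[i] ≃ ℤ[i]` (Euclidean division by `M`). [folklore] -/
def classEquiv : (ZMod M × ZMod M) × ℤ[i] ≃ ℤ[i] :=
  Equiv.ofBijective (fun p ↦ pt M (classRep M p.1) p.2) (by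
    constructor
    · rintro ⟨cl, y⟩ ⟨cl', y'⟩ h
      simp only at h
      have hcl : cl = cl' := by
        have h1 := congrArg (GaussianTheta.cls M) h
        rwa [pt_classRep, pt_classRep, GaussianTheta.cls_rep, GaussianTheta.cls_rep] at h1
      subst hcl
      simp only [Prod.mk.injEq, true_and]
      exact pt_injective M _ h
    · intro x
      obtain ⟨y, hy⟩ := GaussianTheta.exists_rep_eq M (c := GaussianTheta.cls M x) rfl
      refine ⟨(GaussianTheta.cls M x, ⟨y.1, y.2⟩), ?_⟩
      simp only
      rw [pt_classRep]
      exact hy)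

/-- `classEquiv M (cl, y) = classRep cl + M y`. [folklore] -/
theorem classEquiv_apply (p : (ZMod M × ZMod M) × ℤ[i]) :
    classEquiv M p = pt M (classRep M p.1) p.2 := rfl

/-- `(2 + 2i) ∣ 4` in `ℤ[i]` (`4 = (2 + 2i)(1 - i)`). [folklore] -/
theorem two_add_two_I_dvd_four : (⟨2, 2⟩ : ℤ[i]) ∣ (4 : ℤ[i]) :=
  ⟨⟨1, -1⟩, by decide⟩

omit [NeZero M] in
/-- **For `4 ∣ M`, primarity is constant on the cosets modulo `M`**: `c + M y` is primary iff `c`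
is (`2 + 2i ∣ 4 ∣ M`). [cite: FriedlanderIwaniecAnnals1998, §16 after (16.16)] -/
theorem isPrimary_pt_iff (h4 : 4 ∣ M) (c y : ℤ[i]) : IsPrimary (pt M c y) ↔ IsPrimary c := by
  obtain ⟨m, hm⟩ := h4
  have hd : (⟨2, 2⟩ : ℤ[i]) ∣ (M : ℤ[i]) * y := by
    refine Dvd.dvd.mul_right ?_ _
    rw [hm, Nat.cast_mul, Nat.cast_ofNat]
    exact Dvd.dvd.mul_right two_add_two_I_dvd_four _
  rw [isPrimary_iff_dvd, isPrimary_iff_dvd, pt, show c + (M : ℤ[i]) * y - 1 = (c - 1) + (M : ℤ[i]) * y by ring]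
  constructor
  · intro h; simpa using dvd_sub h hd
  · intro h; exact dvd_add h hd

omit [NeZero M] in
/-- A character value is constant on a coset: `χ(c + M y) = χ(c)`. [folklore] -/
theorem mulChar_toQuot_pt (χ : MulChar (GaussQuot M) ℂ) (c y : ℤ[i]) :
    χ (toQuot M (pt M c y)) = χ (toQuot M c) := by
  congr 1
  rw [toQuot_eq_toQuot_iff, pt]
  exact ⟨y, by ring⟩

omit [NeZero M] in
/-- A primary Gaussian integer is nonzero, so no point of a primary coset vanishes. [folklore] -/
theorem pt_ne_zero_of_isPrimary (h4 : 4 ∣ M) {c : ℤ[i]} (hc : IsPrimary c) (y : ℤ[i]) :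
    pt M c y ≠ 0 :=
  ((isPrimary_pt_iff h4 c y).mpr hc).ne_zero

/-! ### The Hecke `L`-function -/

variable (M) in
/-- **The Hecke `L`-function of `ℚ(i)` to the modulus `M` (`4 ∣ M`) with the character `χ` of
`(ℤ[i]/Mℤ[i])ˣ` and the Grössencharakter `(z/|z|)^k`**, as the finite combination
`L(s, ψ) = ∑_{c mod M primary} χ(c) Z_k(s + k/2; c, M)` of continued coset zeta functions; for
`Re s > 1` it is `∑_{z primary} χ(z) z^k N(z)^{-(s + k/2)} = ∑_{z primary} χ(z) (z/|z|)^k N(z)^{-s}`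
(`hasSum_heckeL`). This is `L(s, ψ)` of FI (16.16)–(16.17), `ψ(z) = χ(z)(z/|z|)^k` on primary `z`
(`z` is the primary generator of the odd ideal `(z)`). [cite: FriedlanderIwaniecAnnals1998, (16.16)-(16.17)] -/
def heckeL (χ : MulChar (GaussQuot M) ℂ) (k : ℕ) (s : ℂ) : ℂ :=
  ∑ cl : ZMod M × ZMod M,
    if IsPrimary (classRep M cl) then χ (toQuot M (classRep M cl)) * cosetL M (classRep M cl) k s else 0

/-- A finite family of `HasSum`s over the fibres of `classEquiv` assembles to a `HasSum` over `ℤ[i]`.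
[folklore] -/
theorem hasSum_of_classes {f : ℤ[i] → ℂ} {a : ZMod M × ZMod M → ℂ}
    (h : ∀ cl, HasSum (fun y : ℤ[i] ↦ f (pt M (classRep M cl) y)) (a cl)) :
    HasSum f (∑ cl, a cl) := by
  classical
  set g : (ZMod M × ZMod M) × ℤ[i] → ℂ := f ∘ classEquiv M with hg
  -- the fibre families, extended by zero
  set F : (ZMod M × ZMod M) → (ZMod M × ZMod M) × ℤ[i] → ℂ :=
    fun cl p ↦ if p.1 = cl then g p else 0 with hF
  have hF1 : ∀ cl, HasSum (F cl) (a cl) := by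
    intro cl
    have hinj : Function.Injective (fun y : ℤ[i] ↦ (cl, y)) := fun y y' hy ↦ by
      simpa using hy
    have hsupp : ∀ p : (ZMod M × ZMod M) × ℤ[i], p ∉ Set.range (fun y : ℤ[i] ↦ (cl, y)) → F cl p = 0 := by
      rintro ⟨cl', y⟩ hp
      simp only [hF]
      rw [if_neg]
      rintro rfl
      exact hp ⟨y, rfl⟩
    refine (hinj.hasSum_iff hsupp).mp ?_
    have : (F cl ∘ fun y : ℤ[i] ↦ (cl, y)) = fun y : ℤ[i] ↦ f (pt M (classRep M cl) y) := by
      funext y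
      simp [hF, hg, classEquiv_apply]
    rw [this]
    exact h cl
  have hsum : HasSum (fun p ↦ ∑ cl ∈ (Finset.univ : Finset (ZMod M × ZMod M)), F cl p) (∑ cl, a cl) :=
    hasSum_sum fun cl _ ↦ hF1 cl
  have hg' : HasSum g (∑ cl, a cl) := by
    refine hsum.congr_fun fun p ↦ ?_
    simp only [hF]
    rw [Finset.sum_ite_eq Finset.univ p.1 (fun _ ↦ g p), if_pos (Finset.mem_univ _)]
  exact (classEquiv M).hasSum_iff.mp hg'

/-- **The Dirichlet series**: for `4 ∣ M` and `Re s > 1`,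
`L(s, ψ) = ∑_{z ∈ ℤ[i] primary} χ(z) z^k N(z)^{-(s + k/2)}` (absolutely convergent).
[cite: FriedlanderIwaniecAnnals1998, (16.17)] -/
theorem hasSum_heckeL (h4 : 4 ∣ M) (χ : MulChar (GaussQuot M) ℂ) (k : ℕ) {s : ℂ} (hs : 1 < s.re) :
    HasSum (fun z : ℤ[i] ↦ if IsPrimary z then
        χ (toQuot M z) * (z : ℂ) ^ k / (((z.norm : ℝ)) : ℂ) ^ (s + (k : ℂ) / 2) else 0)
      (heckeL M χ k s) := by
  unfold heckeL
  refine hasSum_of_classes fun cl ↦ ?_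
  set c : ℤ[i] := classRep M cl with hc
  by_cases hprim : IsPrimary c
  · rw [if_pos hprim]
    have hsre : (k : ℝ) / 2 + 1 < (s + (k : ℂ) / 2).re := by rw [re_add_half]; linarith
    have hZ := (hasSum_cosetZeta (M := M) (c := c) k hsre).mul_left (χ (toQuot M c))
    refine hZ.congr_fun fun y ↦ ?_
    rw [if_pos ((isPrimary_pt_iff h4 c y).mpr hprim), if_neg (pt_ne_zero_of_isPrimary h4 hprim y),
      mulChar_toQuot_pt, mul_div_assoc]
  · rw [if_neg hprim]
    convert hasSum_zero (α := ℂ) (β := ℤ[i]) using 1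
    funext y
    rw [if_neg (fun h ↦ hprim ((isPrimary_pt_iff h4 c y).mp h))]

/-- `(z/|z|)^k N(z)^{-s} = z^k N(z)^{-(s + k/2)}` for `z ≠ 0` (the two normalisations of the
Grössencharakter). [folklore] -/
theorem angular_div_cpow {z : ℤ[i]} (hz : z ≠ 0) (k : ℕ) (s : ℂ) :
    ((z : ℂ) / (‖(z : ℂ)‖ : ℂ)) ^ k / (((z.norm : ℝ)) : ℂ) ^ s =
      (z : ℂ) ^ k / (((z.norm : ℝ)) : ℂ) ^ (s + (k : ℂ) / 2) := by
  have hN : (0 : ℝ) < (z.norm : ℝ) := by exact_mod_cast GaussianInt.norm_pos.mpr hz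
  have hNc : (((z.norm : ℝ)) : ℂ) ≠ 0 := ofReal_ne_zero.mpr hN.ne'
  have hnorm : ((‖(z : ℂ)‖ : ℝ) : ℂ) ^ k = (((z.norm : ℝ)) : ℂ) ^ ((k : ℂ) / 2) := by
    have h1 : (‖(z : ℂ)‖ : ℝ) = ((z.norm : ℝ)) ^ (1 / 2 : ℝ) := by
      rw [GaussianTheta.norm_toComplex]
    rw [h1, ← ofReal_pow, ← Real.rpow_natCast, ← Real.rpow_mul hN.le, ofReal_cpow hN.le]
    congr 1
    push_cast
    ring
  rw [div_pow, hnorm, div_div, ← cpow_add _ _ hNc]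
  congr 2
  ring

/-- **The Dirichlet series in FI's normalisation**: for `4 ∣ M` and `Re s > 1`,
`L(s, ψ) = ∑_{z primary} χ(z) (z/|z|)^k N(z)^{-s}`. [cite: FriedlanderIwaniecAnnals1998, (16.16)-(16.17)] -/
theorem hasSum_heckeL' (h4 : 4 ∣ M) (χ : MulChar (GaussQuot M) ℂ) (k : ℕ) {s : ℂ} (hs : 1 < s.re) :
    HasSum (fun z : ℤ[i] ↦ if IsPrimary z then
        χ (toQuot M z) * ((z : ℂ) / (‖(z : ℂ)‖ : ℂ)) ^ k / (((z.norm : ℝ)) : ℂ) ^ s else 0)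
      (heckeL M χ k s) := by
  refine (hasSum_heckeL h4 χ k hs).congr_fun fun z ↦ ?_
  by_cases hz : IsPrimary z
  · rw [if_pos hz, if_pos hz, mul_div_assoc, mul_div_assoc, angular_div_cpow hz.ne_zero]
  · rw [if_neg hz, if_neg hz]

/-- **`L(s, ψ)` is entire for `k ≥ 1`** (a finite sum of entire coset zeta functions).
[cite: FriedlanderIwaniecAnnals1998, §16 after (16.17)] -/
theorem differentiable_heckeL (χ : MulChar (GaussQuot M) ℂ) {k : ℕ} (hk : k ≠ 0) :
    Differentiable ℂ (heckeL M χ k) := by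
  have h : heckeL M χ k = fun s ↦ ∑ cl : ZMod M × ZMod M,
      (if IsPrimary (classRep M cl) then χ (toQuot M (classRep M cl)) * cosetL M (classRep M cl) k s
        else 0) := rfl
  rw [h]
  refine Differentiable.fun_sum fun cl _ ↦ ?_
  by_cases hp : IsPrimary (classRep M cl)
  · simp only [if_pos hp]
    exact (differentiable_cosetL hk).const_mul _
  · simp only [if_neg hp]
    exact differentiable_const 0

/-- **`L(s, ψ)` is holomorphic at every `s ≠ 0, 1`** (all `k`). [cite: FriedlanderIwaniecAnnals1998, §16 after (16.17)] -/
theorem differentiableAt_heckeL (χ : MulChar (GaussQuot M) ℂ) (k : ℕ) {s : ℂ} (hs0 : s ≠ 0) (hs1 : s ≠ 1) :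
    DifferentiableAt ℂ (heckeL M χ k) s := by
  rcases Nat.eq_zero_or_pos k with rfl | hk
  · have h : heckeL M χ 0 = fun s ↦ ∑ cl : ZMod M × ZMod M,
        (if IsPrimary (classRep M cl) then χ (toQuot M (classRep M cl)) * cosetL M (classRep M cl) 0 s
          else 0) := rfl
    rw [h]
    refine DifferentiableAt.fun_sum fun cl _ ↦ ?_
    by_cases hp : IsPrimary (classRep M cl)
    · simp only [if_pos hp]
      have hZ : DifferentiableAt ℂ (cosetL M (classRep M cl) 0) s := by
        have : cosetL M (classRep M cl) 0 = cosetZeta M (classRep M cl) 0 := by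
          funext w; exact cosetL_zero_eq w
        rw [this]
        exact differentiableAt_cosetZeta 0 hs0 hs1
      exact hZ.const_mul _
    · simp only [if_neg hp]
      exact differentiableAt_const 0
  · exact (differentiable_heckeL χ hk.ne').differentiableAt

/-! ### `k = 0`: the entire version when `ψ` is nontrivial -/

variable (M) in
/-- The entire function `L^E(s) = ∑_{c primary} χ(c) · dslope E_c 1 s` (`E_c = (s-1) Z_0(s; c, M)`,
`dslope E_c 1 s = (E_c(s) - E_c(1))/(s - 1)`); when `∑_{c primary} χ(c) = 0` (i.e. `ψ = χ`
nontrivial) it equals `L(s, χ)` off `s = 0, 1`, so `L(s, χ)` is entire (`heckeLE_eq`).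
[cite: FriedlanderIwaniecAnnals1998, §16 after (16.17)] -/
def heckeLE (χ : MulChar (GaussQuot M) ℂ) (s : ℂ) : ℂ :=
  ∑ cl : ZMod M × ZMod M,
    if IsPrimary (classRep M cl) then χ (toQuot M (classRep M cl)) * dslope (cosetZetaE M (classRep M cl)) 1 s
      else 0

/-- `dslope E_c 1` is entire. [folklore] -/
theorem differentiable_dslope_cosetZetaE (c : ℤ[i]) : Differentiable ℂ (dslope (cosetZetaE M c) 1) := by
  have h := (Complex.differentiableOn_dslope (f := cosetZetaE M c) (s := Set.univ) (c := 1)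
    Filter.univ_mem).mpr differentiable_cosetZetaE.differentiableOn
  exact differentiableOn_univ.mp h

/-- **`L^E` is entire.** [cite: FriedlanderIwaniecAnnals1998, §16 after (16.17)] -/
theorem differentiable_heckeLE (χ : MulChar (GaussQuot M) ℂ) : Differentiable ℂ (heckeLE M χ) := by
  have h : heckeLE M χ = fun s ↦ ∑ cl : ZMod M × ZMod M,
      (if IsPrimary (classRep M cl) then χ (toQuot M (classRep M cl)) * dslope (cosetZetaE M (classRep M cl)) 1 s
        else 0) := rfl
  rw [h]
  refine Differentiable.fun_sum fun cl _ ↦ ?_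
  by_cases hp : IsPrimary (classRep M cl)
  · simp only [if_pos hp]
    exact (differentiable_dslope_cosetZetaE _).const_mul _
  · simp only [if_neg hp]
    exact differentiable_const 0

/-- `dslope E_c 1 s = Z_0(s; c, M) - (π/M²)/(s - 1)` for `s ≠ 0, 1`. [folklore] -/
theorem dslope_cosetZetaE_eq {c : ℤ[i]} {s : ℂ} (hs0 : s ≠ 0) (hs1 : s ≠ 1) :
    dslope (cosetZetaE M c) 1 s = cosetZeta M c 0 s - (π / (M : ℂ) ^ 2) / (s - 1) := by
  have h1s : s - 1 ≠ 0 := sub_ne_zero.mpr hs1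
  rw [dslope_of_ne _ hs1, slope_def_field, cosetZetaE_eq hs0 hs1, cosetZetaE_one]
  field_simp

/-- **`L^E(s) = L(s, χ)` for `s ≠ 0, 1` when `∑_{c primary} χ(c) = 0`** — so `L(s, χ)` extends to an
entire function for such `χ` ("entire apart from a simple pole at `s = 1` in case of trivial `ψ`").
[cite: FriedlanderIwaniecAnnals1998, §16 after (16.17)] -/
theorem heckeLE_eq (χ : MulChar (GaussQuot M) ℂ)
    (hχ : ∑ cl : ZMod M × ZMod M, (if IsPrimary (classRep M cl) then χ (toQuot M (classRep M cl)) else 0) = 0)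
    {s : ℂ} (hs0 : s ≠ 0) (hs1 : s ≠ 1) :
    heckeLE M χ s = heckeL M χ 0 s := by
  unfold heckeLE heckeL
  have key : ∀ cl : ZMod M × ZMod M,
      (if IsPrimary (classRep M cl) then
          χ (toQuot M (classRep M cl)) * dslope (cosetZetaE M (classRep M cl)) 1 s else 0) =
        (if IsPrimary (classRep M cl) then
          χ (toQuot M (classRep M cl)) * cosetL M (classRep M cl) 0 s else 0) -
        (if IsPrimary (classRep M cl) then χ (toQuot M (classRep M cl)) else 0) *
          ((π / (M : ℂ) ^ 2) / (s - 1)) := by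
    intro cl
    by_cases hp : IsPrimary (classRep M cl)
    · rw [if_pos hp, if_pos hp, if_pos hp, dslope_cosetZetaE_eq hs0 hs1, cosetL_zero_eq]
      ring
    · rw [if_neg hp, if_neg hp, if_neg hp]; ring
  simp_rw [key]
  rw [Finset.sum_sub_distrib, ← Finset.sum_mul, hχ, zero_mul, sub_zero]

/-! ### Polynomial bounds, uniform in the modulus -/

/-- The number of classes is `M²`. [folklore] -/
theorem card_classes : Fintype.card (ZMod M × ZMod M) = M ^ 2 := by
  rw [Fintype.card_prod, ZMod.card, sq]

/-- Values of `χ` have norm `≤ 1`. [folklore] -/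
theorem norm_mulChar_le_one (χ : MulChar (GaussQuot M) ℂ) (x : GaussQuot M) : ‖χ x‖ ≤ 1 :=
  Literature.NumberTheory.Sieve.FriedlanderIwaniecPrimes.norm_mulChar_apply_le_one χ x

/-- **`‖L(s, ψ)‖ ≤ ∑_{z ≠ 0} N(z)^{-Re s}` for `Re s > 1`** (uniformly in `M`, `χ`, `k`).
[cite: FriedlanderIwaniecAnnals1998, (16.18)] -/
theorem norm_heckeL_le_normSum (h4 : 4 ∣ M) (χ : MulChar (GaussQuot M) ℂ) (k : ℕ) {s : ℂ}
    (hs : 1 < s.re) :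
    ‖heckeL M χ k s‖ ≤ ∑' x : ℤ[i], ((x.norm : ℤ) : ℝ) ^ (-s.re) := by
  have hsum := GaussianTheta.summable_norm_rpow_neg hs
  rw [← (hasSum_heckeL h4 χ k hs).tsum_eq]
  refine tsum_of_norm_bounded hsum.hasSum fun z ↦ ?_
  by_cases hz : IsPrimary z
  · rw [if_pos hz]
    exact norm_term_natural_le (norm_mulChar_le_one χ _) k s z hz.ne_zero
  · rw [if_neg hz, norm_zero]; exact GaussianHecke.normSum_term_nonneg _ z

/-- **Uniform polynomial bound for `L(s, ψ)`, `k ≥ 1`**: for `Re s ≥ -1/2`,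
`‖L(s, ψ)‖ ≤ M³ · normSum(3/2) · ‖(k/2 + 1) + s‖²` (`M²` primary classes at most, each coset function
bounded by `norm_cosetL_le_mul_sq`). [cite: FriedlanderIwaniecAnnals1998, (16.18)] -/
theorem norm_heckeL_le (χ : MulChar (GaussQuot M) ℂ) {k : ℕ} (hk : k ≠ 0) {s : ℂ} (hs : -1 / 2 ≤ s.re) :
    ‖heckeL M χ k s‖ ≤ ((M : ℝ) ^ 3 * ∑' x : ℤ[i], ((x.norm : ℤ) : ℝ) ^ (-(3 / 2 : ℝ))) *
      ‖((k : ℂ) / 2 + 1) + s‖ ^ 2 := by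
  set B : ℝ := ((M : ℝ) * ∑' x : ℤ[i], ((x.norm : ℤ) : ℝ) ^ (-(3 / 2 : ℝ))) *
    ‖((k : ℂ) / 2 + 1) + s‖ ^ 2 with hB
  have hB0 : 0 ≤ B := by
    have := GaussianHecke.normSum_pos (show (1 : ℝ) < 3 / 2 by norm_num)
    positivity
  have hterm : ∀ cl : ZMod M × ZMod M,
      ‖(if IsPrimary (classRep M cl) then χ (toQuot M (classRep M cl)) * cosetL M (classRep M cl) k s
        else 0)‖ ≤ B := by
    intro cl
    by_cases hp : IsPrimary (classRep M cl)
    · rw [if_pos hp, norm_mul]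
      calc ‖χ (toQuot M (classRep M cl))‖ * ‖cosetL M (classRep M cl) k s‖
          ≤ 1 * B := mul_le_mul (norm_mulChar_le_one χ _) (norm_cosetL_le_mul_sq hk hs) (norm_nonneg _) zero_le_one
        _ = B := one_mul B
    · rw [if_neg hp, norm_zero]; exact hB0
  calc ‖heckeL M χ k s‖ ≤ ∑ cl : ZMod M × ZMod M, B := norm_sum_le_of_le _ fun cl _ ↦ hterm cl
    _ = (M : ℝ) ^ 2 * B := by rw [Finset.sum_const, Finset.card_univ, card_classes, nsmul_eq_mul]; push_cast; ring
    _ = ((M : ℝ) ^ 3 * ∑' x : ℤ[i], ((x.norm : ℤ) : ℝ) ^ (-(3 / 2 : ℝ))) *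
          ‖((k : ℂ) / 2 + 1) + s‖ ^ 2 := by rw [hB]; ring

/-- **Uniform polynomial bound for `(s - 1) L(s, χ)`-type sums, `k = 0`**: for `Re s ≥ -1/2`,
`‖∑_{c primary} χ(c) E_c(s)‖ ≤ M³ · normSum(3/2) · ‖2 + s‖³`. [cite: FriedlanderIwaniecAnnals1998, (16.18)] -/
theorem norm_sum_cosetZetaE_le (χ : MulChar (GaussQuot M) ℂ) {s : ℂ} (hs : -1 / 2 ≤ s.re) :
    ‖∑ cl : ZMod M × ZMod M, (if IsPrimary (classRep M cl) then
        χ (toQuot M (classRep M cl)) * cosetZetaE M (classRep M cl) s else 0)‖ ≤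
      ((M : ℝ) ^ 3 * ∑' x : ℤ[i], ((x.norm : ℤ) : ℝ) ^ (-(3 / 2 : ℝ))) * ‖(2 : ℂ) + s‖ ^ 3 := by
  set B : ℝ := ((M : ℝ) * ∑' x : ℤ[i], ((x.norm : ℤ) : ℝ) ^ (-(3 / 2 : ℝ))) * ‖(2 : ℂ) + s‖ ^ 3 with hB
  have hB0 : 0 ≤ B := by
    have := GaussianHecke.normSum_pos (show (1 : ℝ) < 3 / 2 by norm_num)
    positivity
  have hterm : ∀ cl : ZMod M × ZMod M,
      ‖(if IsPrimary (classRep M cl) then χ (toQuot M (classRep M cl)) * cosetZetaE M (classRep M cl) s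
        else 0)‖ ≤ B := by
    intro cl
    by_cases hp : IsPrimary (classRep M cl)
    · rw [if_pos hp, norm_mul]
      calc ‖χ (toQuot M (classRep M cl))‖ * ‖cosetZetaE M (classRep M cl) s‖
          ≤ 1 * B := mul_le_mul (norm_mulChar_le_one χ _) (norm_cosetZetaE_le hs) (norm_nonneg _) zero_le_one
        _ = B := one_mul B
    · rw [if_neg hp, norm_zero]; exact hB0
  calc ‖∑ cl : ZMod M × ZMod M, (if IsPrimary (classRep M cl) then
        χ (toQuot M (classRep M cl)) * cosetZetaE M (classRep M cl) s else 0)‖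
      ≤ ∑ cl : ZMod M × ZMod M, B := norm_sum_le_of_le _ fun cl _ ↦ hterm cl
    _ = (M : ℝ) ^ 2 * B := by rw [Finset.sum_const, Finset.card_univ, card_classes, nsmul_eq_mul]; push_cast; ring
    _ = ((M : ℝ) ^ 3 * ∑' x : ℤ[i], ((x.norm : ℤ) : ℝ) ^ (-(3 / 2 : ℝ))) * ‖(2 : ℂ) + s‖ ^ 3 := by
        rw [hB]; ring

/-- For `∑_{c primary} χ(c) = 0` and `s ≠ 1`: `L^E(s) = (∑_{c primary} χ(c) E_c(s)) / (s - 1)`.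
[folklore] -/
theorem heckeLE_eq_sum_div (χ : MulChar (GaussQuot M) ℂ)
    (hχ : ∑ cl : ZMod M × ZMod M, (if IsPrimary (classRep M cl) then χ (toQuot M (classRep M cl)) else 0) = 0)
    {s : ℂ} (hs1 : s ≠ 1) :
    heckeLE M χ s = (∑ cl : ZMod M × ZMod M, (if IsPrimary (classRep M cl) then
        χ (toQuot M (classRep M cl)) * cosetZetaE M (classRep M cl) s else 0)) / (s - 1) := by
  have h1s : s - 1 ≠ 0 := sub_ne_zero.mpr hs1
  unfold heckeLE
  have key : ∀ cl : ZMod M × ZMod M,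
      (if IsPrimary (classRep M cl) then
          χ (toQuot M (classRep M cl)) * dslope (cosetZetaE M (classRep M cl)) 1 s else 0) =
        (if IsPrimary (classRep M cl) then
          χ (toQuot M (classRep M cl)) * cosetZetaE M (classRep M cl) s else 0) / (s - 1) -
        (if IsPrimary (classRep M cl) then χ (toQuot M (classRep M cl)) else 0) *
          ((π / (M : ℂ) ^ 2) / (s - 1)) := by
    intro cl
    by_cases hp : IsPrimary (classRep M cl)
    · rw [if_pos hp, if_pos hp, if_pos hp, dslope_of_ne _ hs1, slope_def_field, cosetZetaE_one]
      field_simp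
    · rw [if_neg hp, if_neg hp, if_neg hp]; ring
  simp_rw [key]
  rw [Finset.sum_sub_distrib, ← Finset.sum_mul, hχ, zero_mul, sub_zero, Finset.sum_div]

/-- **Uniform polynomial bound for the entire `L^E` away from `s = 1`**: for `Re s ≥ -1/2`,
`‖s - 1‖ ≥ r > 0` and `∑_{c primary} χ(c) = 0`: `‖L^E(s)‖ ≤ r⁻¹ M³ normSum(3/2) ‖2 + s‖³`.
[cite: FriedlanderIwaniecAnnals1998, (16.18)] -/
theorem norm_heckeLE_le_of_le_norm_sub_one (χ : MulChar (GaussQuot M) ℂ)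
    (hχ : ∑ cl : ZMod M × ZMod M, (if IsPrimary (classRep M cl) then χ (toQuot M (classRep M cl)) else 0) = 0)
    {s : ℂ} (hs : -1 / 2 ≤ s.re) {r : ℝ} (hr : 0 < r) (hrs : r ≤ ‖s - 1‖) :
    ‖heckeLE M χ s‖ ≤ r⁻¹ * (((M : ℝ) ^ 3 * ∑' x : ℤ[i], ((x.norm : ℤ) : ℝ) ^ (-(3 / 2 : ℝ))) *
      ‖(2 : ℂ) + s‖ ^ 3) := by
  have hs1 : s ≠ 1 := by
    intro h; rw [h, sub_self, norm_zero] at hrs; linarith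
  rw [heckeLE_eq_sum_div χ hχ hs1, norm_div]
  have hb := norm_sum_cosetZetaE_le (M := M) χ hs
  rw [div_le_iff₀ (lt_of_lt_of_le hr hrs)]
  calc _ ≤ ((M : ℝ) ^ 3 * ∑' x : ℤ[i], ((x.norm : ℤ) : ℝ) ^ (-(3 / 2 : ℝ))) * ‖(2 : ℂ) + s‖ ^ 3 := hb
    _ = r⁻¹ * (((M : ℝ) ^ 3 * ∑' x : ℤ[i], ((x.norm : ℤ) : ℝ) ^ (-(3 / 2 : ℝ))) * ‖(2 : ℂ) + s‖ ^ 3) * r := by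
        field_simp
    _ ≤ r⁻¹ * (((M : ℝ) ^ 3 * ∑' x : ℤ[i], ((x.norm : ℤ) : ℝ) ^ (-(3 / 2 : ℝ))) * ‖(2 : ℂ) + s‖ ^ 3) *
          ‖s - 1‖ := by
        have h0 : 0 ≤ r⁻¹ * (((M : ℝ) ^ 3 * ∑' x : ℤ[i], ((x.norm : ℤ) : ℝ) ^ (-(3 / 2 : ℝ))) *
            ‖(2 : ℂ) + s‖ ^ 3) := by
          have := GaussianHecke.normSum_pos (show (1 : ℝ) < 3 / 2 by norm_num)
          positivity
        exact mul_le_mul_of_nonneg_left hrs h0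

/-- **Uniform polynomial bound for `L^E` near `s = 1`** (maximum modulus on `|s - 1| ≤ 1/2`):
for `‖s - 1‖ ≤ 1/2` and `∑_{c primary} χ(c) = 0`, `‖L^E(s)‖ ≤ 2 · 4³ · M³ normSum(3/2)`.
[cite: FriedlanderIwaniecAnnals1998, (16.18)] -/
theorem norm_heckeLE_le_near_one (χ : MulChar (GaussQuot M) ℂ)
    (hχ : ∑ cl : ZMod M × ZMod M, (if IsPrimary (classRep M cl) then χ (toQuot M (classRep M cl)) else 0) = 0)
    {s : ℂ} (hs : ‖s - 1‖ ≤ 1 / 2) :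
    ‖heckeLE M χ s‖ ≤ 2 * (((M : ℝ) ^ 3 * ∑' x : ℤ[i], ((x.norm : ℤ) : ℝ) ^ (-(3 / 2 : ℝ))) * 4 ^ 3) := by
  set K : ℝ := ((M : ℝ) ^ 3 * ∑' x : ℤ[i], ((x.norm : ℤ) : ℝ) ^ (-(3 / 2 : ℝ))) with hK
  have hK0 : 0 ≤ K := by
    have := GaussianHecke.normSum_pos (show (1 : ℝ) < 3 / 2 by norm_num)
    positivity
  have hU : Bornology.IsBounded (Metric.ball (1 : ℂ) (1 / 2)) := Metric.isBounded_ball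
  have hd : DiffContOnCl ℂ (heckeLE M χ) (Metric.ball (1 : ℂ) (1 / 2)) :=
    (differentiable_heckeLE χ).diffContOnCl
  have hfr : ∀ w ∈ frontier (Metric.ball (1 : ℂ) (1 / 2)), ‖heckeLE M χ w‖ ≤ 2 * (K * 4 ^ 3) := by
    intro w hw
    rw [frontier_ball _ (by norm_num : (1 : ℝ) / 2 ≠ 0)] at hw
    have hw' : ‖w - 1‖ = 1 / 2 := by simpa [dist_eq_norm] using hw
    have hwre : -1 / 2 ≤ w.re := by
      have h1 : |(w - 1).re| ≤ ‖w - 1‖ := Complex.abs_re_le_norm _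
      rw [hw', sub_re, one_re] at h1
      have := (abs_le.mp h1).1
      linarith
    have hb := norm_heckeLE_le_of_le_norm_sub_one χ hχ hwre (by norm_num : (0 : ℝ) < 1 / 2) hw'.ge
    have hX : ‖(2 : ℂ) + w‖ ≤ 4 := by
      calc ‖(2 : ℂ) + w‖ = ‖(w - 1) + 3‖ := by ring_nf
        _ ≤ ‖w - 1‖ + ‖(3 : ℂ)‖ := norm_add_le _ _
        _ ≤ 4 := by rw [hw']; norm_num
    calc ‖heckeLE M χ w‖ ≤ (1 / 2 : ℝ)⁻¹ * (K * ‖(2 : ℂ) + w‖ ^ 3) := hb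
      _ ≤ (1 / 2 : ℝ)⁻¹ * (K * 4 ^ 3) := by gcongr
      _ = 2 * (K * 4 ^ 3) := by norm_num
  have hmem : s ∈ closure (Metric.ball (1 : ℂ) (1 / 2)) := by
    rw [closure_ball _ (by norm_num : (1 : ℝ) / 2 ≠ 0), Metric.mem_closedBall, dist_eq_norm]
    exact hs
  exact Complex.norm_le_of_forall_mem_frontier_norm_le hU hd hfr hmem

end GaussianCosetTheta

end Literature.NumberTheory.LFunctions
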